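/-
Origin: expansion seat `literature-prover-pub-hodgecm-cf-kudla-howe-rallis-g3-0`, handover #1 2026-08-18T06:02:44Z (`HOME/pub-hodgecm-cf-kudla-howe-rallis-g3/lean/CfKHRg3/SeesawDescentSmoke.lean`, md5 49bc514d, 118 lines);
landed by the gen-6 packager in gate run 24 as `HodgeCM/Automorphic/SeesawDescentSmoke.lean` (import ^import CfKHRg3\.→import HodgeCM.Automorphic. ×1).
-/
/-
Origin: HOME/pub-hodgecm-cf-kudla-howe-rallis-g3/lean/CfKHRg3/SeesawDescentSmoke.lean — session
literature-prover-pub-hodgecm-cf-kudla-howe-rallis-g3-0 (unit pub-hodgecm-cf-kudla-howe-rallis-g3, CITED-FACT seat (4) gen 3).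
NON-VACUITY GUARD (nothing cited, nothing consumed; delete freely).  Intended place:
`HodgeCM/Automorphic/SeesawDescentSmoke.lean`; imports the landed `HodgeCM.Automorphic.SeesawSplittingSmoke`
(run 22) and the NEW `HodgeCM.Automorphic.SeesawSplittingDescent` (WIP import `CfKHRg3.SeesawSplittingDescent`
to be rewritten; build it first).
-/
import Summits.HodgeConjecture.HodgeCM.Automorphic.SeesawSplittingSmoke
import Summits.HodgeConjecture.HodgeCM.Automorphic.SeesawSplittingDescent

set_option autoImplicit false

/-!
# Smoke model for the descent derivation (vacuity guard for `SeesawCover.HKSDescent`)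

The scalar model of `SeesawSplittingSmoke.lean` (trivial symplectic groups, standard models `ℂ`, covers
`Mp(𝕎₁) = Mp(𝕎₂) = Mp(𝕎) = ℂˣ`, `j̃(z₁,z₂) = z₁z₂`, `κ_j = (z ↦ z · id)`) carries an `HKSDescent` structure:
the MVW extensions (B) are `1 → ℂˣ =→ ℂˣ → 1 → 1` (`A = ℂˣ`, `i = id`, `p` trivial, `u = id`), the trivial
symplectic groups are perfect, `j̃` is over the (trivial) projections and `ℂˣ`-equivariant, the doublings `dbl`
are the identity of the trivial group, and (1.17)/(1.18) hold with `z = m`.  Hence every field of `HKSDescent`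
is jointly satisfiable with `StandardModelTensor`, `IotaDiag`, `IsPullback`, `SplittingRestricts`, `hKu`, `hθ`
of the run-22 smoke, and the NEW chain `pending_GUsideCompatible_of_descent → splittingsCompatible_of →
of_parts` fires WITHOUT the field `jt_compat` being supplied: `smoke_descent_pending_GUsideCompatible`,
`smoke_descent_unitaryWeilRepMultiplicative`.  It also re-derives the run-22 smoke's hand-checked `jt_compat`
as an instance of the kernel theorem (`smoke_jt_compat_derived`).  This says nothing about PerL's actual covers.
-/

noncomputable section

namespace HodgeCM.Automorphic.ThetaPending.SeesawSmoke

open HodgeCM.Literature.Theta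

/-- The three covers `ℂˣ` of the scalar model as MVW extensions (B) of the trivial symplectic groups by
`A = ℂˣ`. -/
abbrev V : MetaplecticSumCovers C.M₁ C.M₂ C.M where
  A := ℂˣ
  Sp₁ := PUnit
  Sp₂ := PUnit
  Sp := PUnit
  i₁ := MonoidHom.id ℂˣ
  i₂ := MonoidHom.id ℂˣ
  i := MonoidHom.id ℂˣ
  p₁ := 1
  p₂ := 1
  p := 1
  diag := 1

/-- (Ported verbatim from the HodgeCMPerL package; no docstring in the source.) -/
theorem isCentralExt_id_one :
    IsCentralExt (MonoidHom.id ℂˣ) (1 : ℂˣ →* PUnit) := by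
  refine ⟨fun a => ?_, fun m _ => ⟨m, rfl⟩, fun x => ⟨1, Subsingleton.elim _ _⟩⟩
  exact Subgroup.mem_center_iff.mpr fun g => mul_comm g a

/-- (Ported verbatim from the HodgeCMPerL package; no docstring in the source.) -/
theorem V_centralExtensions : V.CentralExtensions :=
  ⟨isCentralExt_id_one, isCentralExt_id_one, isCentralExt_id_one⟩

/-- (Ported verbatim from the HodgeCMPerL package; no docstring in the source.) -/
theorem V_isJ : V.IsJ C.jt := by
  refine ⟨fun _ _ => Subsingleton.elim _ _, fun a m₁ m₂ => ?_, fun a m₁ m₂ => ?_⟩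
  · change a * m₁ * m₂ = a * (m₁ * m₂)
    rw [mul_assoc]
  · change m₁ * (a * m₂) = a * (m₁ * m₂)
    rw [mul_left_comm]

/-- The trivial group is its own commutator subgroup. -/
theorem commutator_punit_eq_top : commutator PUnit.{1} = ⊤ :=
  Subsingleton.elim _ _

/-- (Ported verbatim from the HodgeCMPerL package; no docstring in the source.) -/
theorem V_basePerfect : V.BasePerfect :=
  ⟨commutator_punit_eq_top, commutator_punit_eq_top⟩

/-- **Every field of `HKSDescent` holds in the scalar model.** -/
def XD : C.HKSDescent where
  D := D
  toDouble := id
  κ₁ := scaleHom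
  κ₂ := scaleHom
  κ := scaleHom
  κ_injective := scaleHom_injective
  desc₁ := fun h => (iotaTilde₁_D h).symm
  desc₂ := fun h => (iotaTilde₂_D h).symm
  desc := fun h => (iotaTilde_D h).symm
  V := V
  u := MonoidHom.id ℂˣ
  central := V_centralExtensions
  jt_isJ := V_isJ
  perfect := V_basePerfect
  dbl₁ := id
  dbl₂ := id
  dbl := id
  dbl_diag := fun _ _ => rfl
  over₁ := fun m => ⟨m, (opOf₁_R _ m).symm⟩
  over₂ := fun m => ⟨m, (opOf₂_R _ m).symm⟩
  overSum := fun m => ⟨m, (opOf_R _ m).symm⟩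
  κi₁ := fun _ => rfl
  κi₂ := fun _ => rfl
  κi := fun _ => rfl

/-- The NEW chain's first link fires: `Pending_GUsideCompatible` for `C` WITHOUT supplying `jt_compat`. -/
theorem smoke_descent_pending_GUsideCompatible : C.Pending_GUsideCompatible :=
  WeilProductDatum.SeesawCover.pending_GUsideCompatible_of_descent XD R_standardModelTensor D_iotaDiag

/-- The run-22 smoke's hand-supplied `jt_compat` is now an INSTANCE of the kernel theorem. -/
theorem smoke_jt_compat_derived (m₁ m₂ : ℂˣ) :
    scaleHom (C.jt (m₁, m₂)) = R.jOp (scaleHom m₁, scaleHom m₂) :=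
  XD.jt_compat R_standardModelTensor m₁ m₂

/-- **The whole chain fires through the descent route:** PerL's seesaw statement for `Dw`, obtained ONLY
through `of_parts` ∘ `splittingsCompatible_of` ∘ `pending_GUsideCompatible_of_descent`. -/
theorem smoke_descent_unitaryWeilRepMultiplicative : Dw.Pending_unitaryWeilRepMultiplicative :=
  WeilProductDatum.SeesawCover.of_parts C_isPullback
    (WeilProductDatum.SeesawCover.splittingsCompatible_of C_splittingRestricts
      smoke_descent_pending_GUsideCompatible)
    (TensorProduct.lid ℂ ℂ) C_hKu C_hθ

end HodgeCM.Automorphic.ThetaPending.SeesawSmoke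

end
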